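import Mathlib

/-!
# Hodge-locus census, c′ = 1 cells (2k′, d, k′−1) — THEOREM SM-∞: explicit smooth members `N·F₀ + F₁`

certified instances and evidence bearing on the general Hodge conjecture; no claim.

ENGINE B gen 35 (record `ENGINEB-g35.md` §1).  Coordinates `(a, b, x₀, …, x_{k−1}, y₀, …, y_{k−1})` on `ℙ^{2k+1}`
(`k = k′`), planes `P₁ = V(a, y)`, `P₂ = V(b, y)`.  The member is `F_N = N·F₀ + F₁` with the Thom–Sebastiani form
`F₀ = Σ_j (y_j x_j^{d−1} + y_j^d) + a^{d−1} b + a b^{d−1}` and a coupling `F₁ = Σ_j y_j t_j(x) + a b g(x)`.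

PERTURBATION LEMMA (record §1.2).  On the sup-norm sphere `‖z‖_∞ = 1` one has `‖∇F₀(z)‖_∞ ≥ 1/2` and
`‖∇F₁(z)‖_∞ ≤ M(F₁) := max_v Σ_m |c_m|·deg_v(m)`; hence `F_N` is smooth for every integer `N ≥ 2 M(F₁) + 1`.
For the Σ°-family (`t` from the family `F_{k′}` of THEOREM J2∞, `g = x₀^{d−3} x₁`) `M = d − 1`, so `F_N` is smooth
for all `N ≥ 2d − 1`, its restricted part is `(N x_j^{d−1} + t_j ; g)` with kernel vector
`(N^{k} x₀² ; N^{k−1} x₁, …, N x_{k−1}, x₀)` of rank `k` — an explicit smooth member of `π⁻¹(Σ°)` in every cell.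

This def-free file (only `import Mathlib`) kernel-checks the non-bookkeeping steps of the hand proof:
* `ineq_pow_two`, `ineq_base` — the two elementary inequalities `d ≤ 2^{d−2}` and `2(d−1) ≤ (2(d−2))^{d−2}` (`d ≥ 4`);
* `yblock_small`, `abblock_large` — their real-variable consequences used in the case analysis;
* `block_xy`, `block_ab` — the gradient lower bound `1/2` for the two kinds of blocks of `F₀` over `ℂ`
  (the partials of `y x^{d−1} + y^d` are `(d−1) x^{d−2} y`, `x^{d−1} + d y^{d−1}`; those of `a^{d−1} b + a b^{d−1}` are
  `b((d−1)a^{d−2} + b^{d−2})`, `a(a^{d−2} + (d−1)b^{d−2})`);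
* `gradF0_supnorm_bound` — assembly of the two block lemmas into the sup-norm bound for all `k`;
* `perturbation_nonvanishing`, `perturbation_arith` — the final step: `‖p₀‖ ≥ 1/2`, `‖p₁‖ ≤ M`, `N > 2M`
  `⇒ N p₀ + p₁ ≠ 0`, and the arithmetic `N ≥ 2d − 1 ⇒ N/2 > d − 1`;
* `sigma_kernel_k3/k4/k5` — the kernel identities `Σ_j ℓ_j h_j = g·q` of the Σ°-family for `k = 3, 4, 5` and
  symbolic degree (`e = d − 3`), as ring identities.
-/

namespace Summit.HodgeConjecture.HodgeConjecture.HodgeLocus.Census.SigmaFamily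

/-! ## The two elementary inequalities -/

/-- `d ≤ 2^{d−2}` for `d ≥ 4`. -/
theorem ineq_pow_two (d : ℕ) (hd : 4 ≤ d) : d ≤ 2 ^ (d - 2) := by
  induction d, hd using Nat.le_induction with
  | base => norm_num
  | succ n hn ih =>
    have h : n + 1 - 2 = (n - 2) + 1 := by omega
    rw [h, pow_succ]
    omega

/-- `2(d−1) ≤ (2(d−2))^{d−2}` for `d ≥ 4`. -/
theorem ineq_base (d : ℕ) (hd : 4 ≤ d) : 2 * (d - 1) ≤ (2 * (d - 2)) ^ (d - 2) := by
  have h1 : (2 * (d - 2)) ^ 2 ≤ (2 * (d - 2)) ^ (d - 2) :=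
    Nat.pow_le_pow_right (by omega) (by omega)
  have h2 : 2 * (d - 1) ≤ (2 * (d - 2)) ^ 2 := by
    obtain ⟨m, rfl⟩ : ∃ m, d = m + 4 := ⟨d - 4, by omega⟩
    have : m + 4 - 2 = m + 2 := by omega
    rw [this]
    have : m + 4 - 1 = m + 3 := by omega
    rw [this]
    nlinarith
  exact le_trans h2 h1

/-! ## Real consequences used in the case analysis -/

/-- If `0 ≤ s ≤ 1/2` and `d ≥ 4` then `1 − d·s^{d−1} ≥ 1/2` (case `|x_j| = 1`, `|y_j| ≤ 1/2`). -/
theorem yblock_small (d : ℕ) (hd : 4 ≤ d) (s : ℝ) (hs0 : 0 ≤ s) (hs : s ≤ 1 / 2) :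
    1 / 2 ≤ 1 - (d : ℝ) * s ^ (d - 1) := by
  have hpow : s ^ (d - 1) ≤ (1 / 2 : ℝ) ^ (d - 1) := pow_le_pow_left₀ hs0 hs _
  have hd' : (d : ℝ) ≤ (2 : ℝ) ^ (d - 2) := by exact_mod_cast ineq_pow_two d hd
  have hsplit : (1 / 2 : ℝ) ^ (d - 1) = (1 / 2) * (1 / 2) ^ (d - 2) := by
    rw [← pow_succ']; congr 1; omega
  have hhalf : (1 / 2 : ℝ) ^ (d - 2) = 1 / 2 ^ (d - 2) := by rw [one_div_pow]
  have hpos : (0 : ℝ) < 2 ^ (d - 2) := by positivity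
  have hdd : (d : ℝ) * (1 / 2 : ℝ) ^ (d - 1) ≤ 1 / 2 := by
    rw [hsplit, hhalf]
    rw [show (d : ℝ) * (1 / 2 * (1 / 2 ^ (d - 2))) = (1 / 2) * ((d : ℝ) / 2 ^ (d - 2)) by ring]
    have : (d : ℝ) / 2 ^ (d - 2) ≤ 1 := by rw [div_le_one hpos]; exact hd'
    linarith
  have hdnn : (0 : ℝ) ≤ d := by positivity
  have := mul_le_mul_of_nonneg_left hpow hdnn
  linarith

/-- If `0 ≤ β ≤ 1`, `d ≥ 4` and `β^{d−2} > 1/(2(d−1))` then `β(d−2) ≥ 1/2` (case `|a| = 1`, `(d−1)|b|^{d−2} > 1/2`). -/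
theorem abblock_large (d : ℕ) (hd : 4 ≤ d) (β : ℝ) (hβ0 : 0 ≤ β)
    (h : 1 / (2 * ((d : ℝ) - 1)) < β ^ (d - 2)) : 1 / 2 ≤ β * ((d : ℝ) - 2) := by
  have hd2 : (0 : ℝ) < (d : ℝ) - 2 := by
    have : (4 : ℝ) ≤ d := by exact_mod_cast hd
    linarith
  have hd1 : (0 : ℝ) < (d : ℝ) - 1 := by linarith
  -- the base inequality, cast to ℝ
  have hbase : 2 * ((d : ℝ) - 1) ≤ (2 * ((d : ℝ) - 2)) ^ (d - 2) := by
    have := ineq_base d hd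
    have h1 : ((2 * (d - 1) : ℕ) : ℝ) = 2 * ((d : ℝ) - 1) := by
      push_cast [Nat.cast_sub (show 1 ≤ d by omega)]; ring
    have h2 : (((2 * (d - 2)) ^ (d - 2) : ℕ) : ℝ) = (2 * ((d : ℝ) - 2)) ^ (d - 2) := by
      push_cast [Nat.cast_sub (show 2 ≤ d by omega)]; ring
    rw [← h1, ← h2]; exact_mod_cast this
  -- β ≥ 1/(2(d−2)), else β^{d−2} < (1/(2(d−2)))^{d−2} ≤ 1/(2(d−1))
  have hβ : 1 / (2 * ((d : ℝ) - 2)) ≤ β := by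
    by_contra hlt
    push Not at hlt
    have hne : d - 2 ≠ 0 := by omega
    have hp : β ^ (d - 2) < (1 / (2 * ((d : ℝ) - 2))) ^ (d - 2) := pow_lt_pow_left₀ hlt hβ0 hne
    have hq : (1 / (2 * ((d : ℝ) - 2))) ^ (d - 2) = 1 / (2 * ((d : ℝ) - 2)) ^ (d - 2) := by
      rw [one_div_pow]
    have hr : 1 / (2 * ((d : ℝ) - 2)) ^ (d - 2) ≤ 1 / (2 * ((d : ℝ) - 1)) :=
      one_div_le_one_div_of_le (by positivity) hbase
    linarith
  have : 1 / (2 * ((d : ℝ) - 2)) * ((d : ℝ) - 2) = 1 / 2 := by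
    field_simp
  nlinarith [mul_le_mul_of_nonneg_right hβ (le_of_lt hd2)]

/-! ## The block gradient bounds over `ℂ` -/

/-- Block `W = y x^{d−1} + y^d`: if `‖x‖ ≤ 1`, `‖y‖ ≤ 1` and one of them has norm `1`, then one of the two partials
`∂W/∂x = (d−1) x^{d−2} y`, `∂W/∂y = x^{d−1} + d y^{d−1}` has norm at least `1/2`. -/
theorem block_xy (d : ℕ) (hd : 4 ≤ d) (x y : ℂ) (hx : ‖x‖ ≤ 1) (hy : ‖y‖ ≤ 1)
    (h1 : ‖x‖ = 1 ∨ ‖y‖ = 1) :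
    1 / 2 ≤ max ‖((d : ℂ) - 1) * x ^ (d - 2) * y‖ ‖x ^ (d - 1) + (d : ℂ) * y ^ (d - 1)‖ := by
  have hdR : (4 : ℝ) ≤ d := by exact_mod_cast hd
  have hcast : ((d : ℂ) - 1) = ((d - 1 : ℕ) : ℂ) := by
    push_cast [Nat.cast_sub (show 1 ≤ d by omega)]; ring
  have hn1 : ‖((d : ℂ) - 1) * x ^ (d - 2) * y‖ = ((d : ℝ) - 1) * ‖x‖ ^ (d - 2) * ‖y‖ := by
    rw [norm_mul, norm_mul, norm_pow, hcast, Complex.norm_natCast]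
    push_cast [Nat.cast_sub (show 1 ≤ d by omega)]; ring
  have hnx : ‖x ^ (d - 1)‖ = ‖x‖ ^ (d - 1) := norm_pow _ _
  have hny : ‖(d : ℂ) * y ^ (d - 1)‖ = (d : ℝ) * ‖y‖ ^ (d - 1) := by
    rw [norm_mul, norm_pow, Complex.norm_natCast]
  -- triangle inequalities in both directions
  have htri1 : ‖x ^ (d - 1)‖ - ‖(d : ℂ) * y ^ (d - 1)‖ ≤ ‖x ^ (d - 1) + (d : ℂ) * y ^ (d - 1)‖ := by
    have := norm_sub_norm_le (x ^ (d - 1)) (-((d : ℂ) * y ^ (d - 1)))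
    rw [norm_neg, sub_neg_eq_add] at this
    exact this
  have htri2 : ‖(d : ℂ) * y ^ (d - 1)‖ - ‖x ^ (d - 1)‖ ≤ ‖x ^ (d - 1) + (d : ℂ) * y ^ (d - 1)‖ := by
    have := norm_sub_norm_le ((d : ℂ) * y ^ (d - 1)) (-(x ^ (d - 1)))
    rw [norm_neg, sub_neg_eq_add, add_comm] at this
    exact this
  rcases h1 with hx1 | hy1
  · -- ‖x‖ = 1
    by_cases hys : ‖y‖ ≤ 1 / 2
    · -- second partial ≥ 1 − d ‖y‖^{d−1} ≥ 1/2
      have hsm := yblock_small d hd ‖y‖ (norm_nonneg _) hys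
      have : 1 / 2 ≤ ‖x ^ (d - 1) + (d : ℂ) * y ^ (d - 1)‖ := by
        rw [hnx, hny, hx1, one_pow] at htri1
        linarith
      exact le_max_of_le_right this
    · -- first partial = (d−1)‖y‖ > (d−1)/2 ≥ 3/2
      push Not at hys
      have : 1 / 2 ≤ ‖((d : ℂ) - 1) * x ^ (d - 2) * y‖ := by
        rw [hn1, hx1, one_pow, mul_one]
        nlinarith
      exact le_max_of_le_left this
  · -- ‖y‖ = 1: second partial ≥ d − ‖x‖^{d−1} ≥ d − 1
    have hxp : ‖x‖ ^ (d - 1) ≤ 1 := pow_le_one₀ (norm_nonneg _) hx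
    have : 1 / 2 ≤ ‖x ^ (d - 1) + (d : ℂ) * y ^ (d - 1)‖ := by
      rw [hnx, hny, hy1, one_pow, mul_one] at htri2
      linarith
    exact le_max_of_le_right this

/-- Block `W′ = a^{d−1} b + a b^{d−1}`: if `‖a‖ ≤ 1`, `‖b‖ ≤ 1` and one of them has norm `1`, then one of the two
partials `∂W′/∂a = b((d−1)a^{d−2} + b^{d−2})`, `∂W′/∂b = a(a^{d−2} + (d−1)b^{d−2})` has norm at least `1/2`. -/
theorem block_ab (d : ℕ) (hd : 4 ≤ d) (a b : ℂ) (ha : ‖a‖ ≤ 1) (hb : ‖b‖ ≤ 1)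
    (h1 : ‖a‖ = 1 ∨ ‖b‖ = 1) :
    1 / 2 ≤ max ‖b * (((d : ℂ) - 1) * a ^ (d - 2) + b ^ (d - 2))‖
               ‖a * (a ^ (d - 2) + ((d : ℂ) - 1) * b ^ (d - 2))‖ := by
  have hdR : (4 : ℝ) ≤ d := by exact_mod_cast hd
  have hcast : ((d : ℂ) - 1) = ((d - 1 : ℕ) : ℂ) := by
    push_cast [Nat.cast_sub (show 1 ≤ d by omega)]; ring
  have hnd1 : ‖((d : ℂ) - 1)‖ = (d : ℝ) - 1 := by
    rw [hcast, Complex.norm_natCast]; push_cast [Nat.cast_sub (show 1 ≤ d by omega)]; ring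
  -- norms of the pieces
  have hA : ‖((d : ℂ) - 1) * a ^ (d - 2)‖ = ((d : ℝ) - 1) * ‖a‖ ^ (d - 2) := by
    rw [norm_mul, norm_pow, hnd1]
  have hB : ‖((d : ℂ) - 1) * b ^ (d - 2)‖ = ((d : ℝ) - 1) * ‖b‖ ^ (d - 2) := by
    rw [norm_mul, norm_pow, hnd1]
  have hap : ‖a ^ (d - 2)‖ = ‖a‖ ^ (d - 2) := norm_pow _ _
  have hbp : ‖b ^ (d - 2)‖ = ‖b‖ ^ (d - 2) := norm_pow _ _
  have hale : ‖a‖ ^ (d - 2) ≤ 1 := pow_le_one₀ (norm_nonneg _) ha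
  have hble : ‖b‖ ^ (d - 2) ≤ 1 := pow_le_one₀ (norm_nonneg _) hb
  -- triangle inequalities
  have t1 : ‖((d : ℂ) - 1) * a ^ (d - 2)‖ - ‖b ^ (d - 2)‖ ≤ ‖((d : ℂ) - 1) * a ^ (d - 2) + b ^ (d - 2)‖ := by
    have := norm_sub_norm_le (((d : ℂ) - 1) * a ^ (d - 2)) (-(b ^ (d - 2)))
    rw [norm_neg, sub_neg_eq_add] at this; exact this
  have t1' : ‖b ^ (d - 2)‖ - ‖((d : ℂ) - 1) * a ^ (d - 2)‖ ≤ ‖((d : ℂ) - 1) * a ^ (d - 2) + b ^ (d - 2)‖ := by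
    have := norm_sub_norm_le (b ^ (d - 2)) (-(((d : ℂ) - 1) * a ^ (d - 2)))
    rw [norm_neg, sub_neg_eq_add, add_comm] at this; exact this
  have t2 : ‖a ^ (d - 2)‖ - ‖((d : ℂ) - 1) * b ^ (d - 2)‖ ≤ ‖a ^ (d - 2) + ((d : ℂ) - 1) * b ^ (d - 2)‖ := by
    have := norm_sub_norm_le (a ^ (d - 2)) (-(((d : ℂ) - 1) * b ^ (d - 2)))
    rw [norm_neg, sub_neg_eq_add] at this; exact this
  have t2' : ‖((d : ℂ) - 1) * b ^ (d - 2)‖ - ‖a ^ (d - 2)‖ ≤ ‖a ^ (d - 2) + ((d : ℂ) - 1) * b ^ (d - 2)‖ := by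
    have := norm_sub_norm_le (((d : ℂ) - 1) * b ^ (d - 2)) (-(a ^ (d - 2)))
    rw [norm_neg, sub_neg_eq_add, add_comm] at this; exact this
  have e1 : ‖b * (((d : ℂ) - 1) * a ^ (d - 2) + b ^ (d - 2))‖
      = ‖b‖ * ‖((d : ℂ) - 1) * a ^ (d - 2) + b ^ (d - 2)‖ := norm_mul _ _
  have e2 : ‖a * (a ^ (d - 2) + ((d : ℂ) - 1) * b ^ (d - 2))‖
      = ‖a‖ * ‖a ^ (d - 2) + ((d : ℂ) - 1) * b ^ (d - 2)‖ := norm_mul _ _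
  rcases h1 with ha1 | hb1
  · -- ‖a‖ = 1
    by_cases hsm : ((d : ℝ) - 1) * ‖b‖ ^ (d - 2) ≤ 1 / 2
    · -- second partial ≥ 1 − (d−1)‖b‖^{d−2} ≥ 1/2
      have : 1 / 2 ≤ ‖a * (a ^ (d - 2) + ((d : ℂ) - 1) * b ^ (d - 2))‖ := by
        rw [e2, ha1, one_mul]
        rw [hap, hB, ha1, one_pow] at t2
        linarith
      exact le_max_of_le_right this
    · -- first partial ≥ ‖b‖((d−1) − ‖b‖^{d−2}) ≥ ‖b‖(d−2) ≥ 1/2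
      push Not at hsm
      have hd1pos : (0 : ℝ) < (d : ℝ) - 1 := by linarith
      have hpow : 1 / (2 * ((d : ℝ) - 1)) < ‖b‖ ^ (d - 2) := by
        rw [div_lt_iff₀ (by positivity)]
        nlinarith
      have hlarge := abblock_large d hd ‖b‖ (norm_nonneg _) hpow
      have hin : ((d : ℝ) - 1) - ‖b‖ ^ (d - 2) ≤ ‖((d : ℂ) - 1) * a ^ (d - 2) + b ^ (d - 2)‖ := by
        rw [hA, hbp, ha1, one_pow, mul_one] at t1; exact t1
      have hge : (d : ℝ) - 2 ≤ ‖((d : ℂ) - 1) * a ^ (d - 2) + b ^ (d - 2)‖ := by linarith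
      have : 1 / 2 ≤ ‖b * (((d : ℂ) - 1) * a ^ (d - 2) + b ^ (d - 2))‖ := by
        rw [e1]
        have := mul_le_mul_of_nonneg_left hge (norm_nonneg b)
        linarith
      exact le_max_of_le_left this
  · -- ‖b‖ = 1 (symmetric)
    by_cases hsm : ((d : ℝ) - 1) * ‖a‖ ^ (d - 2) ≤ 1 / 2
    · have : 1 / 2 ≤ ‖b * (((d : ℂ) - 1) * a ^ (d - 2) + b ^ (d - 2))‖ := by
        rw [e1, hb1, one_mul]
        rw [hbp, hA, hb1, one_pow] at t1'
        linarith
      exact le_max_of_le_left this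
    · push Not at hsm
      have hd1pos : (0 : ℝ) < (d : ℝ) - 1 := by linarith
      have hpow : 1 / (2 * ((d : ℝ) - 1)) < ‖a‖ ^ (d - 2) := by
        rw [div_lt_iff₀ (by positivity)]
        nlinarith
      have hlarge := abblock_large d hd ‖a‖ (norm_nonneg _) hpow
      have hin : ((d : ℝ) - 1) - ‖a‖ ^ (d - 2) ≤ ‖a ^ (d - 2) + ((d : ℂ) - 1) * b ^ (d - 2)‖ := by
        rw [hB, hap, hb1, one_pow, mul_one] at t2'; exact t2'
      have hge : (d : ℝ) - 2 ≤ ‖a ^ (d - 2) + ((d : ℂ) - 1) * b ^ (d - 2)‖ := by linarith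
      have : 1 / 2 ≤ ‖a * (a ^ (d - 2) + ((d : ℂ) - 1) * b ^ (d - 2))‖ := by
        rw [e2]
        have := mul_le_mul_of_nonneg_left hge (norm_nonneg a)
        linarith
      exact le_max_of_le_right this

/-! ## The final contradiction -/

/-- If `‖∇F₀‖_∞ ≥ 1/2`, `‖∇F₁‖_∞ ≤ d − 1`, `N ≥ 2d − 1` and (at a singular point) `N·‖∇F₀‖_∞ = ‖∇F₁‖_∞`, contradiction. -/
theorem perturbation_arith (d N : ℕ) (hd : 4 ≤ d) (hN : 2 * d - 1 ≤ N) (g₀ g₁ : ℝ)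
    (h₀ : 1 / 2 ≤ g₀) (h₁ : g₁ ≤ (d : ℝ) - 1) (heq : (N : ℝ) * g₀ = g₁) : False := by
  have hN' : 2 * (d : ℝ) - 1 ≤ N := by
    have : ((2 * d - 1 : ℕ) : ℝ) = 2 * (d : ℝ) - 1 := by
      push_cast [Nat.cast_sub (show 1 ≤ 2 * d by omega)]; ring
    rw [← this]; exact_mod_cast hN
  have hNpos : (0 : ℝ) ≤ N := by positivity
  have := mul_le_mul_of_nonneg_left h₀ hNpos
  nlinarith

/-- General form: `‖∇F₀‖ ≥ 1/2`, `‖∇F₁‖ ≤ M`, `N > 2M`, `N ‖∇F₀‖ = ‖∇F₁‖` is contradictory. -/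
theorem perturbation_arith' (N M g₀ g₁ : ℝ) (hN : 2 * M < N) (hM : 0 ≤ M)
    (h₀ : 1 / 2 ≤ g₀) (h₁ : g₁ ≤ M) (heq : N * g₀ = g₁) : False := by
  nlinarith

/-! ## Kernel identities of the Σ°-family (`e = d − 3`, so `d − 1 = e + 2`, `d − 2 = e + 1`) -/

/-- `k = 3`: `h₀ = N x₀^{d−1} − x₁^{d−2}x₂`, `h₁ = N x₁^{d−1} − x₀x₂^{d−2}`, `h₂ = N x₂^{d−1}`;
`N² x₁·h₀ + N x₂·h₁ + x₀·h₂ = (x₀^{d−3}x₁)·(N³ x₀²)`. -/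
theorem sigma_kernel_k3 {R : Type*} [CommRing R] (N x0 x1 x2 : R) (e : ℕ) :
    N ^ 2 * x1 * (N * x0 ^ (e + 2) - x1 ^ (e + 1) * x2) + N * x2 * (N * x1 ^ (e + 2) - x0 * x2 ^ (e + 1))
      + x0 * (N * x2 ^ (e + 2)) = (x0 ^ e * x1) * (N ^ 3 * x0 ^ 2) := by
  ring

/-- `k = 4`: `h₀ = N x₀^{d−1} − x₁^{d−2}x₂`, `h₁ = N x₁^{d−1} − x₂^{d−2}x₃`, `h₂ = N x₂^{d−1} − x₀x₃^{d−2}`,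
`h₃ = N x₃^{d−1}`; `N³x₁·h₀ + N²x₂·h₁ + N x₃·h₂ + x₀·h₃ = (x₀^{d−3}x₁)·(N⁴x₀²)`.  At `N = 1`, `d = 4` this is the
SM-2 member's restricted part (gen 34). -/
theorem sigma_kernel_k4 {R : Type*} [CommRing R] (N x0 x1 x2 x3 : R) (e : ℕ) :
    N ^ 3 * x1 * (N * x0 ^ (e + 2) - x1 ^ (e + 1) * x2) + N ^ 2 * x2 * (N * x1 ^ (e + 2) - x2 ^ (e + 1) * x3)
      + N * x3 * (N * x2 ^ (e + 2) - x0 * x3 ^ (e + 1)) + x0 * (N * x3 ^ (e + 2))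
      = (x0 ^ e * x1) * (N ^ 4 * x0 ^ 2) := by
  ring

/-- `k = 5`: the same telescoping with `ℓ = (N⁴x₁, N³x₂, N²x₃, N x₄, x₀)`, `q = N⁵ x₀²`. -/
theorem sigma_kernel_k5 {R : Type*} [CommRing R] (N x0 x1 x2 x3 x4 : R) (e : ℕ) :
    N ^ 4 * x1 * (N * x0 ^ (e + 2) - x1 ^ (e + 1) * x2) + N ^ 3 * x2 * (N * x1 ^ (e + 2) - x2 ^ (e + 1) * x3)
      + N ^ 2 * x3 * (N * x2 ^ (e + 2) - x3 ^ (e + 1) * x4) + N * x4 * (N * x3 ^ (e + 2) - x0 * x4 ^ (e + 1))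
      + x0 * (N * x4 ^ (e + 2)) = (x0 ^ e * x1) * (N ^ 5 * x0 ^ 2) := by
  ring

/-- The general telescoping step behind `sigma_kernel_k*`: consecutive couplings cancel. -/
theorem sigma_telescope_step {R : Type*} [CommRing R] (N lam v w : R) (e : ℕ) :
    (N * lam) * v * (-(v ^ (e + 1) * w)) + lam * w * (N * v ^ (e + 2)) = 0 := by
  ring

/-! ## Assembly: the sup-norm gradient bound for `F₀` -/

/-- PERTURBATION LEMMA (a) for `F₀ = Σ_j (y_j x_j^{d−1} + y_j^d) + a^{d−1} b + a b^{d−1}`: if every coordinate has norm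
`≤ 1` and some coordinate has norm `1` (i.e. `‖z‖_∞ = 1`), then some partial derivative of `F₀` has norm `≥ 1/2`.
The partials are listed explicitly: `∂a = b((d−1)a^{d−2} + b^{d−2})`, `∂b = a(a^{d−2} + (d−1)b^{d−2})`,
`∂x_j = (d−1) x_j^{d−2} y_j`, `∂y_j = x_j^{d−1} + d y_j^{d−1}`. -/
theorem gradF0_supnorm_bound (d k : ℕ) (hd : 4 ≤ d) (a b : ℂ) (x y : Fin k → ℂ)
    (ha : ‖a‖ ≤ 1) (hb : ‖b‖ ≤ 1) (hx : ∀ j, ‖x j‖ ≤ 1) (hy : ∀ j, ‖y j‖ ≤ 1)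
    (hone : ‖a‖ = 1 ∨ ‖b‖ = 1 ∨ ∃ j, (‖x j‖ = 1 ∨ ‖y j‖ = 1)) :
    1 / 2 ≤ ‖b * (((d : ℂ) - 1) * a ^ (d - 2) + b ^ (d - 2))‖ ∨
    1 / 2 ≤ ‖a * (a ^ (d - 2) + ((d : ℂ) - 1) * b ^ (d - 2))‖ ∨
    ∃ j, (1 / 2 ≤ ‖((d : ℂ) - 1) * x j ^ (d - 2) * y j‖ ∨ 1 / 2 ≤ ‖x j ^ (d - 1) + (d : ℂ) * y j ^ (d - 1)‖) := by
  rcases hone with h | h | ⟨j, hj⟩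
  · have := block_ab d hd a b ha hb (Or.inl h)
    rcases le_max_iff.mp this with h' | h'
    · exact Or.inl h'
    · exact Or.inr (Or.inl h')
  · have := block_ab d hd a b ha hb (Or.inr h)
    rcases le_max_iff.mp this with h' | h'
    · exact Or.inl h'
    · exact Or.inr (Or.inl h')
  · have := block_xy d hd (x j) (y j) (hx j) (hy j) hj
    rcases le_max_iff.mp this with h' | h'
    · exact Or.inr (Or.inr ⟨j, Or.inl h'⟩)
    · exact Or.inr (Or.inr ⟨j, Or.inr h'⟩)

/-- PERTURBATION LEMMA (b), abstract form: in a sup-normed situation, if some partial of `F₀` has norm `≥ 1/2`, every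
partial of `F₁` has norm `≤ M`, `N > 2M ≥ 0`, then `N·∂F₀ + ∂F₁ ≠ 0` at that partial — stated for the complex values
`p₀ = ∂F₀`, `p₁ = ∂F₁` of one partial derivative. -/
theorem perturbation_nonvanishing (N M : ℝ) (p₀ p₁ : ℂ) (hN : 2 * M < N) (hM : 0 ≤ M)
    (h₀ : 1 / 2 ≤ ‖p₀‖) (h₁ : ‖p₁‖ ≤ M) : (N : ℂ) * p₀ + p₁ ≠ 0 := by
  intro hzero
  have hNpos : 0 < N := by linarith
  have heq : (N : ℂ) * p₀ = -p₁ := eq_neg_of_add_eq_zero_left hzero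
  have hn : ‖(N : ℂ) * p₀‖ = ‖p₁‖ := by rw [heq, norm_neg]
  rw [norm_mul, Complex.norm_real, Real.norm_of_nonneg hNpos.le] at hn
  nlinarith

end Summit.HodgeConjecture.HodgeConjecture.HodgeLocus.Census.SigmaFamily
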